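import Mathlib
import Summits.Ventures.PercRepro2.SwOutSevThm
import Summits.Ventures.PercRepro2.SwOutSevSw
import Summits.Ventures.PercRepro2.SwOutSevEscO

/-!
# THEOREM A_sev without the mark condition: the mark `o` may lie in a piece (blind cell
PercRepro2, night-4 g23, 2026-08-27; proofs/NIGHT4-G23.md §2)

Theorem A_sev (`rigidOK_of_mixedJunctionR`, night-4 g22) assumes `o ∉ compU (p r)` — the mark
outside the components of the dropped vertices — because its escaping analysis needs an edge
leaving the region at every piece vertex (`dataPieceOut`), which `hout` does not grant at `o`.
The lemma `not_hull_u_subset_of_not_core_o` (`SwOutSevEscO`) needs those edges only at the piece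
vertices other than `o` and uses the `Q`-membership of the point instead.  This file re-runs the
assembly of `SwOutSevThm` with it: **`rigidOK_of_mixedJunctionR_o`** — the rigid inequality on
every several-arms junction class for every outside colouring, the mark `o` anywhere in
`U ∖ {h, u, p r}` (in a piece included) — and the (SW) corollaries
`reducible_of_mixedJunctionR_o`, `swAll_of_mixedJunctionR_o`, `sw_of_mixedJunctionR_o`.
Everything but the one escaping step is `SwOutSevThm` verbatim.
-/

namespace Summit.Ventures.PercRepro2

namespace MixedArms

open Hull LocRows BigBlock

variable {V : Type*} {E : Type*} [Fintype E] [DecidableEq E]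

open scoped Classical

variable {ends : E → Sym2 V} {ρ : Type*} [Fintype ρ] {U : Set V} {ξ : Config E} {l h o u : V}
  {p : ρ → V}

section Data

variable (hj : MixedJunctionR ends U h u p o) {ζ : Config E} (hζ : ζ ∈ swOutSide ends l h o U ξ)
  (hk : CoreKind ends U h u ζ)
include hj hζ hk

/-- Every vertex of a piece other than the mark `o` has an edge leaving `U`. -/
lemma dataPieceOut_o (i : (mixedDataR ends h u p ζ).ν) :
    ∀ y ∈ (mixedDataR ends h u p ζ).Ah i, y ≠ o → ∃ e z, ends e = s(y, z) ∧ z ∉ U ∧ z ≠ h ∧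
      z ≠ u ∧ (∀ r : (mixedDataR ends h u p ζ).ρ', z ≠ (mixedDataR ends h u p ζ).drop p r) ∧
      z ∉ armsAllR (mixedDataR ends h u p ζ).U (mixedDataR ends h u p ζ).Ah
        (mixedDataR ends h u p ζ).F := by
  intro y hy hyo
  have hHU : extHull ends ζ h u ⊆ U := extHull_subset_of_coreKind hζ hk
  have huU : u ∈ U := hk.2 (Or.inl (mem_cluster_self _ _ _))
  have hyA := dataAh_subset i hy
  have hyarm : y ∈ armC ends h u ζ (p i.1.1) := hyA.1
  obtain ⟨hyH, hyh, hyu⟩ := armsC_subset (armP_mem_armsC_R hj ζ i.1.1) y hyarm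
  rcases hj.hout y (hHU hyH) hyh hyo hyu with ⟨e, z, hez, hzU⟩ | hno
  · refine ⟨e, z, hez, hzU, fun h' => hzU (h' ▸ (mem_outClass.1 (mem_swOutSide.1 hζ).2).2
      (Or.inl (mem_cluster_self _ _ _))), fun h' => hzU (h' ▸ huU),
      fun r h' => hzU (h' ▸ hHU (p_mem_extHull (hj.hup r.1) ζ)),
      fun hz => hzU (hHU (mem_extHull_of_mem_armsAllR hj hz).1)⟩
  · -- `y` has an edge: it is joined to its dropped vertex inside the arm
    exfalso
    obtain ⟨e, y', hey', hy', hyy'⟩ := exists_dead_of_mem_AhOfR hyA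
    by_cases hyy : y = y'
    · exact hno e (by rw [hey', hyy]; exact Sym2.mem_mk_right _ _)
    · have hcl : cluster ends (fun e => decide (e ∈ within ends (AhOfR ends h u p ζ i.1.1))) y = {y} := by
        apply Set.Subset.antisymm
        · intro v hv
          refine mem_of_conn_of_closed (ends := ends)
            (ω := fun e => decide (e ∈ within ends (AhOfR ends h u p ζ i.1.1))) ?_ rfl hv
          intro a ha b hab
          obtain ⟨_, e', -, hends⟩ := openGraph_adj.1 hab
          rw [Set.mem_singleton_iff] at ha
          rw [ha] at hends
          exact absurd (by rw [hends]; exact Sym2.mem_mk_left _ _) (hno e')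
        · intro v hv
          rw [Set.mem_singleton_iff] at hv
          rw [hv]
          exact mem_cluster_self _ _ _
      have : y' ∈ cluster ends (fun e => decide (e ∈ within ends (AhOfR ends h u p ζ i.1.1))) y :=
        conn_symm hyy'
      rw [hcl] at this
      exact hyy this.symm

end Data

section Thm

variable (hj : MixedJunctionR ends U h u p o) (hl : l ∉ U)
include hj hl

section Block

variable {ζ : Config E} (hζ : ζ ∈ swOutSide ends l h o U ξ) (hk : CoreKind ends U h u ζ)
include hζ hk

/-- **The key is constant along the `Q`-points of the block of a core-kind point** (the mark `o`
anywhere). -/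
theorem keyR_eq_of_mem_blockR_core_o {ζ' : Config E}
    (hζ' : ζ' ∈ blockR ends u p (mixedDataR ends h u p ζ))
    (hQ : ζ' ∈ tgtU ends l h {S : Set V | o ∈ S}) :
    ζ' ∈ swOutSide ends l h o U ξ ∧ keyR ends U ξ l h o u p ζ' = Sum.inr (mixedDataR ends h u p ζ) := by
  obtain ⟨q, hq, hqζ⟩ := mem_blockR.1 hζ'
  rw [mixedDataR_base] at hqζ
  subst hqζ
  have hb := mixedBaseR_of_coreKindR hj hl hζ hk
  haveI := nonempty_ι_of_coreKind hj hl hζ hk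
  have hup : ∀ r : (mixedDataR ends h u p ζ).ρ', ∃ e, ends e = s(u, (mixedDataR ends h u p ζ).drop p r) :=
    fun r => hj.hup r.1
  obtain ⟨hqR, hqB⟩ := not_leak_iff_RB.1 hq
  have hcl := realR_mem_outClass hj hl hζ hk hq
  refine ⟨mem_swOutSide.2 ⟨hQ, hcl⟩, ?_⟩
  by_cases hcore : Core q (mixedDataR ends h u p ζ).arm
  · have hk' := coreKind_realR_core hj hl hζ hk hcore
    rw [keyR_of_core hk'.1 hk'.2, mixedDataR_realR_core hj hl hζ hk hcore]
  · -- a slab point: escaping of the mixed kind, its data read off by `baseER`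
    have hslab : TSlab q (mixedDataR ends h u p ζ).arm ∨ BSlab q (mixedDataR ends h u p ζ).arm := by
      rcases (not_leak_iff (mixedDataR ends h u p ζ).arm q).1 hq with hc | hs
      · exact absurd hc hcore
      · exact hs
    have hu' : u ∈ hull ends (mixedRealR ends u (mixedDataR ends h u p ζ).U
        ((mixedDataR ends h u p ζ).drop p) (mixedDataR ends h u p ζ).Ah (mixedDataR ends h u p ζ).F
        (coreBaseOf ends ζ h u) q) h := hb.u_mem_hull_R hup hqR hqB
    have hesc := hb.not_hull_u_subset_of_not_core_o hup hl (dataExt hj hζ hk)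
      (dataPieceOut_o hj hζ hk) (dataAh_dead ζ) hslab hcore hQ
    have hbase := hb.baseER_esc hup (dataP_red hj hl hζ hk) (dataP_blue hj hl hζ hk)
      (fun r e he => dataUP₀ (ζ := ζ) r e he) (fun r e he => dataX₀ hj (ζ := ζ) r e he) hslab
    have hdata : mixedDataR ends h u p ζ = mixedDataR ends h u p (baseER ends U h u p
        (mixedRealR ends u (mixedDataR ends h u p ζ).U ((mixedDataR ends h u p ζ).drop p)
          (mixedDataR ends h u p ζ).Ah (mixedDataR ends h u p ζ).F (coreBaseOf ends ζ h u) q)) := by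
      rw [hbase, mixedDataR_coreBaseOf hj hl hζ hk]
    have hm : MixedKindER ends U ξ l h o u p (mixedRealR ends u (mixedDataR ends h u p ζ).U
        ((mixedDataR ends h u p ζ).drop p) (mixedDataR ends h u p ζ).Ah (mixedDataR ends h u p ζ).F
        (coreBaseOf ends ζ h u) q) :=
      ⟨ζ, hζ, hk, hdata, hζ'⟩
    rw [keyR_of_escMixed hu' hesc hm, ← hdata]

end Block

/-- **Every `Q`-point of the block of a `Q`-point lies in the class with the same key** (the mark
`o` anywhere). -/
theorem keyR_eq_of_mem_blockOfR_o {ζ : Config E} (hζ : ζ ∈ swOutSide ends l h o U ξ) {ζ' : Config E}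
    (hζ' : ζ' ∈ blockOfR ends h u p (keyR ends U ξ l h o u p ζ))
    (hQ : ζ' ∈ tgtU ends l h {S : Set V | o ∈ S}) :
    ζ' ∈ swOutSide ends l h o U ξ ∧ keyR ends U ξ l h o u p ζ' = keyR ends U ξ l h o u p ζ := by
  by_cases hu : u ∉ hull ends ζ h
  · rw [keyR_of_out hu] at hζ' ⊢
    obtain ⟨h1, h2, h3⟩ := (orbitKind_block hl hj.hloop_h hj.hout hζ hu).2.1 ζ' hζ' hQ
    exact ⟨h1, by rw [keyR_of_out h2, h3]⟩
  rw [not_not] at hu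
  by_cases hk : hull ends ζ u ⊆ U
  · rw [keyR_of_core hu hk] at hζ' ⊢
    exact keyR_eq_of_mem_blockR_core_o hj hl hζ ⟨hu, hk⟩ hζ' hQ
  by_cases hm : MixedKindER ends U ξ l h o u p ζ
  · rw [keyR_of_escMixed hu hk hm] at hζ' ⊢
    obtain ⟨ζ₀, hζ₀, hk₀, hdata, -⟩ := hm
    rw [← hdata] at hζ' ⊢
    exact keyR_eq_of_mem_blockR_core_o hj hl hζ₀ hk₀ hζ' hQ
  · rw [keyR_of_plain hu hk hm] at hζ' ⊢
    have hc : CoreFree ends ζ h := coreFree_of_escaping hj.hout hζ hk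
    have hc₀ : CoreFree ends (allRed ends ζ h) h := coreFree_allRed hc
    have hcl₀ : allRed ends ζ h ∈ outClass ends U h ξ :=
      allRed_mem_outClass (mem_swOutSide.1 hζ).2 hc
    have hmem := hζ'
    simp only [blockOfR, orbit, Finset.mem_image, Finset.mem_univ, true_and] at hmem
    obtain ⟨ω', rfl⟩ := hmem
    have hζ'cl : orbitReal ends (allRed ends ζ h) h ω' ∈ swOutSide ends l h o U ξ :=
      mem_swOutSide.2 ⟨hQ, orbitReal_mem_outClass hc₀ hcl₀ ω'⟩
    have hu' : u ∈ hull ends (orbitReal ends (allRed ends ζ h) h ω') h := by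
      rw [hull_orbitReal hc₀, hull_allRed hc]; exact hu
    have hc' : CoreFree ends (orbitReal ends (allRed ends ζ h) h ω') h := coreFree_orbitReal hc₀ ω'
    have hall : allRed ends (orbitReal ends (allRed ends ζ h) h ω') h = allRed ends ζ h := by
      rw [allRed_orbitReal hc₀, allRed_idem hc]
    have hζorb : ζ ∈ orbit ends (allRed ends (orbitReal ends (allRed ends ζ h) h ω') h) h := by
      rw [hall]
      obtain ⟨ω, hω⟩ := exists_orbitReal_eq (ζ₀ := allRed ends ζ h) hc rfl
      simp only [orbit, Finset.mem_image, Finset.mem_univ, true_and]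
      exact ⟨ω, hω⟩
    have hesc' : ¬ hull ends (orbitReal ends (allRed ends ζ h) h ω') u ⊆ U := by
      intro hsub
      apply hm
      have hk' : CoreKind ends U h u (orbitReal ends (allRed ends ζ h) h ω') := ⟨hu', hsub⟩
      refine mixedKindER_of_mem_orbit hj hl hζ'cl hk' ?_ hc' hk hζorb
      exact mem_blockR.2 ⟨qOfR ends h u p _, not_leak_of_core' (core_qOfR _),
        mixedRealR_coreBaseOf_R hj hl hζ'cl hk'⟩
    have hm' : ¬ MixedKindER ends U ξ l h o u p (orbitReal ends (allRed ends ζ h) h ω') := by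
      rintro ⟨ζ₀, hζ₀, hk₀, -, hmem⟩
      exact hm (mixedKindER_of_mem_orbit hj hl hζ₀ hk₀ hmem hc' hk hζorb)
    exact ⟨hζ'cl, by rw [keyR_of_plain hu' hesc' hm', hall]⟩

/-- **THEOREM A_sev, the mark anywhere: the rigid inequality on every several-arms junction
class**, for every outside colouring, without the condition `o ∉ compU (p r)`. -/
theorem rigidOK_of_mixedJunctionR_o : RigidOK ends l h o U ξ :=
  rigidOK_of_blocks ξ (keyR ends U ξ l h o u p) (blockOfR ends h u p)
    (fun _ hζ => mem_blockOfR_keyR hj hl hζ)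
    (fun _ hζ _ hζ' hQ => keyR_eq_of_mem_blockOfR_o hj hl hζ hζ' hQ)
    (fun _ hζ _ h𝓔 => card_blockOfR_le hj hl hζ h𝓔)

end Thm

section Sw

/-- A region with a several-arms junction is a base region of the series reduction (the mark
anywhere). -/
theorem reducible_of_mixedJunctionR_o (hj : MixedJunctionR ends U h u p o) (hl : l ∉ U) :
    Reducible l h o ends U :=
  Reducible.base ends U fun ξ => rigidOK_of_mixedJunctionR_o (ξ := ξ) hj hl

/-- **Row 2′SW-ALL on every graph with a several-arms junction** in `{l}ᶜ`, the mark anywhere. -/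
theorem swAll_of_mixedJunctionR_o (hlh : l ≠ h) (hj : MixedJunctionR ends ({l}ᶜ) h u p o) :
    SwAll ends l h o :=
  swAll_of_reducible l h o hlh (reducible_of_mixedJunctionR_o hj (by simp))

/-- **Row (SW) on every graph with a several-arms junction**, the mark anywhere (the hypothesis
`o ∉ compU (p r)` of `sw_of_mixedJunctionR` dropped). -/
theorem sw_of_mixedJunctionR_o (hlh : l ≠ h) (hj : MixedJunctionR ends ({l}ᶜ) h u p o) :
    Sw ends l h o :=
  sw_of_swAll ends (swAll_of_mixedJunctionR_o hlh hj)

end Sw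

end MixedArms

end Summit.Ventures.PercRepro2
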